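import Summits.AtomisticToContinuum.Crystallization.Theorems.FreeSplittingCertificatesStrictSplittingRuleP1Far

/-!
# `StrictSplittingRule` (stmt-AtomisticToContinuum-12560): ELEMENT VOLUMES of the hcp tet–oct honeycomb — every real cell of the P1 interpolant has volume `√3·a²·h/12` (P1 interpolant object, part 8)

Route `FreeSplittingCertificates`, crux r3 `StrictSplittingRule` (H12⋆ = `stub_coreJointCoercive`), unit b2b-freesplit-B gen 20.
VALUE = the first ingredient of item (2') of HOME FAR-LEMMA-SPEC §16 (c) (the TRANSFER: element volumes + matched-weight receipts): NOT a proof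
of H12⋆, NOT summit progress.

* `p1RefMap e π` — the affine map with integer, unimodular linear part `p1RefLin e π` (`|det| = 1`, `abs_det_p1RefLin`) carrying the corner
  simplex `p1RefCell true 0` onto the piece `p1RefCell e π` (`p1RefCell_eq_image`, via the barycentric compatibility `p1Bary_p1RefMap`);
  hence all twelve reference pieces have the same volume (`volume_p1RefCell_eq`).
* The six pieces of a cube tile the unit cube with pairwise null overlaps (overlaps lie in facet planes, by the conformity lemmas of part 4),
  so that common volume is `1/6` (`volume_p1RefCell`).
* The slab-affine inverse chart has `det L_k = 2/(√3 a² h)` (`det_p1ChartInvCLM`), and a real cell is the preimage of a translated reference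
  piece under it, so **`volume (p1RealCell a h i) = √3·a²·h/12`** (`volume_p1RealCell`) — one sixth of the hcp cell volume per site pair… i.e.
  exactly the volume of each tetrahedron / octahedron-quarter of the honeycomb (`a³/(6√2)` at the ideal ratio).
* `setIntegral_p1RealCell_weight_fpGrad`: `∫_{cell} w(x)·g(fpGrad v x) dx = g(G_i − A)·∫_{cell} w` — the form in which the receipts density
  `fpDen = |x|⁻⁶·fpRec` of a cell enters (`fpRec` of the constant cell gradient times the cell's weight integral).
[folklore: P1 finite elements; change of variables]
-/

noncomputable section

open Set Function Metric MeasureTheory Filter Topology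
open scoped NNReal ENNReal

namespace Summit.AtomisticToContinuum.Crystallization.Theorems.StrictSplittingRuleBirth

/-! ## The reference pieces as unimodular images of the corner simplex -/

/-- Linear part of the reference map of piece `(e, π)`: `p ↦ Σ_j p_j (v_{j+1} − v_0)` (columns = vertex differences, integer entries). -/
def p1RefLin (e : Bool) (π : Fin 6) : (Fin 3 → ℝ) →ₗ[ℝ] (Fin 3 → ℝ) where
  toFun p := p 0 • (p1Vec (p1VertOff e π 1) - p1Vec (p1VertOff e π 0)) + p 1 • (p1Vec (p1VertOff e π 2) - p1Vec (p1VertOff e π 0)) +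
    p 2 • (p1Vec (p1VertOff e π 3) - p1Vec (p1VertOff e π 0))
  map_add' p q := by
    simp only [Pi.add_apply, add_smul]
    abel
  map_smul' c p := by
    simp only [Pi.smul_apply, smul_eq_mul, RingHom.id_apply, smul_add, smul_smul]

/-- The reference map of piece `(e, π)`: vertex `0` plus the linear part (sends the vertices of the corner simplex to those of the piece). -/
def p1RefMap (e : Bool) (π : Fin 6) (p : Fin 3 → ℝ) : Fin 3 → ℝ := p1Vec (p1VertOff e π 0) + p1RefLin e π p

/-- Coordinates of the reference map. -/
theorem p1RefMap_apply (e : Bool) (π : Fin 6) (p : Fin 3 → ℝ) (i : Fin 3) :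
    p1RefMap e π p i = p1Vec (p1VertOff e π 0) i + (p 0 * (p1Vec (p1VertOff e π 1) i - p1Vec (p1VertOff e π 0) i) +
      p 1 * (p1Vec (p1VertOff e π 2) i - p1Vec (p1VertOff e π 0) i) + p 2 * (p1Vec (p1VertOff e π 3) i - p1Vec (p1VertOff e π 0) i)) := by
  simp [p1RefMap, p1RefLin]

/-- **Barycentric compatibility** (even cube): the `m`-th barycentric coordinate of piece `π` at the image point is the `m`-th barycentric
coordinate of the corner simplex. -/
theorem p1Bary_p1RefMap_true (π : Fin 6) (m : Fin 4) (p : Fin 3 → ℝ) : p1Bary true π m (p1RefMap true π p) = p1Bary true 0 m p := by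
  simp only [p1Bary, p1RefMap_apply]
  fin_cases π <;> fin_cases m <;> simp [p1BaryCoef, p1VertOff, p1Vec] <;> ring

/-- **Barycentric compatibility** (odd cube). -/
theorem p1Bary_p1RefMap_false (π : Fin 6) (m : Fin 4) (p : Fin 3 → ℝ) : p1Bary false π m (p1RefMap false π p) = p1Bary true 0 m p := by
  simp only [p1Bary, p1RefMap_apply]
  fin_cases π <;> fin_cases m <;> simp [p1BaryCoef, p1VertOff, p1Vec] <;> ring

/-- **Barycentric compatibility.** -/
theorem p1Bary_p1RefMap (e : Bool) (π : Fin 6) (m : Fin 4) (p : Fin 3 → ℝ) : p1Bary e π m (p1RefMap e π p) = p1Bary true 0 m p := by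
  cases e
  · exact p1Bary_p1RefMap_false π m p
  · exact p1Bary_p1RefMap_true π m p

/-- The linear parts are unimodular: `|det| = 1` (even cube). -/
theorem abs_det_p1RefLin_true (π : Fin 6) : |LinearMap.det (p1RefLin true π)| = 1 := by
  rw [← LinearMap.det_toMatrix', Matrix.det_fin_three]
  simp only [LinearMap.toMatrix'_apply]
  fin_cases π <;> simp [p1RefLin, p1VertOff, p1Vec]

/-- The linear parts are unimodular: `|det| = 1` (odd cube). -/
theorem abs_det_p1RefLin_false (π : Fin 6) : |LinearMap.det (p1RefLin false π)| = 1 := by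
  rw [← LinearMap.det_toMatrix', Matrix.det_fin_three]
  simp only [LinearMap.toMatrix'_apply]
  fin_cases π <;> simp [p1RefLin, p1VertOff, p1Vec]

/-- The linear parts are unimodular: `|det| = 1`. -/
theorem abs_det_p1RefLin (e : Bool) (π : Fin 6) : |LinearMap.det (p1RefLin e π)| = 1 := by
  cases e
  · exact abs_det_p1RefLin_false π
  · exact abs_det_p1RefLin_true π

/-- **Each reference piece is the image of the corner simplex under its reference map.** -/
theorem p1RefCell_eq_image (e : Bool) (π : Fin 6) : p1RefCell e π = p1RefMap e π '' p1RefCell true 0 := by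
  have hdet : LinearMap.det (p1RefLin e π) ≠ 0 := fun h0 => by
    have := abs_det_p1RefLin e π; rw [h0, abs_zero] at this; exact zero_ne_one this
  ext q
  constructor
  · intro hq
    obtain ⟨p, hp⟩ := ((p1RefLin e π).equivOfDetNeZero hdet).surjective (q - p1Vec (p1VertOff e π 0))
    have hp' : p1RefLin e π p = q - p1Vec (p1VertOff e π 0) := hp
    have hΦ : p1RefMap e π p = q := by rw [p1RefMap, hp']; abel
    refine ⟨p, fun m => ?_, hΦ⟩
    rw [← p1Bary_p1RefMap e π m p, hΦ]
    exact hq m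
  · rintro ⟨p, hp, rfl⟩ m
    rw [p1Bary_p1RefMap]
    exact hp m

/-- **All reference pieces have the volume of the corner simplex.** -/
theorem volume_p1RefCell_eq (e : Bool) (π : Fin 6) : volume (p1RefCell e π) = volume (p1RefCell true 0) := by
  rw [p1RefCell_eq_image]
  have himage : p1RefMap e π '' p1RefCell true 0 =
      (fun x => p1Vec (p1VertOff e π 0) + x) '' ((p1RefLin e π) '' p1RefCell true 0) := by
    rw [image_image]; rfl
  rw [himage, image_add_left, measure_preimage_add, MeasureTheory.Measure.addHaar_image_linearMap, abs_det_p1RefLin,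
    ENNReal.ofReal_one, one_mul]

/-! ## The six pieces tile the unit cube: each has volume `1/6` -/

/-- The plane of the `m`-th facet of the reference piece (zero set of the barycentric coordinate), as an affine subspace. -/
def p1RefPlane (e : Bool) (π : Fin 6) (m : Fin 4) : AffineSubspace ℝ (Fin 3 → ℝ) where
  carrier := {p | p1Bary e π m p = 0}
  smul_vsub_vadd_mem' := by
    intro c p₁ p₂ p₃ h₁ h₂ h₃
    simp only [mem_setOf_eq, vsub_eq_sub, vadd_eq_add] at h₁ h₂ h₃ ⊢
    have e1 : p1BaryCLM e π m (p₁ - p₂) = 0 := by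
      have := p1Bary_add e π m p₂ (p₁ - p₂)
      rw [add_sub_cancel] at this
      linarith
    rw [add_comm, p1Bary_add, map_smul, e1, smul_zero, add_zero, h₃]

/-- The facet planes of the reference pieces are proper. -/
theorem p1RefPlane_ne_top (e : Bool) (π : Fin 6) (m : Fin 4) : p1RefPlane e π m ≠ ⊤ := by
  intro htop
  have hmem : p1Vec (p1VertOff e π m) ∈ (p1RefPlane e π m : Set (Fin 3 → ℝ)) := by rw [htop]; simp
  have h0 : p1Bary e π m (p1Vec (p1VertOff e π m)) = 0 := hmem
  rw [p1Bary_vert, if_pos rfl] at h0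
  exact one_ne_zero h0

/-- Distinct pieces of a cube: some vertex of one is a listed non-vertex of the other, with the same parity label (decidable table check). -/
theorem p1Vert_nonvert_of_ne : ∀ (e : Bool) (π π' : Fin 6), π ≠ π' →
    ∃ m m', p1VertOff e π m = p1NonVertOff e π' m' ∧ p1VertPar π m = p1NonVertPar π' m' := by
  decide

/-- **Distinct pieces overlap in a null set** (their intersection lies in a facet plane, by conformity). -/
theorem volume_p1RefCell_inter (e : Bool) {π π' : Fin 6} (hne : π ≠ π') : volume (p1RefCell e π ∩ p1RefCell e π') = 0 := by
  obtain ⟨m, m', hv, hpar⟩ := p1Vert_nonvert_of_ne e π π' hne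
  refine measure_mono_null ?_ (Measure.addHaar_affineSubspace volume (p1RefPlane e π m) (p1RefPlane_ne_top e π m))
  rintro p ⟨hp, hp'⟩
  show p1Bary e π m p = 0
  rw [← p1Hat_vert e π m hp, hpar, hv]
  exact p1Hat_nonvert e π' m' hp'

/-- **The corner simplex — hence every reference piece — has volume `1/6`.** -/
theorem volume_p1RefCell (e : Bool) (π : Fin 6) : volume (p1RefCell e π) = 6⁻¹ := by
  rw [volume_p1RefCell_eq]
  set V := volume (p1RefCell true 0) with hV
  -- the unit cube
  have hcube : volume (Icc (0 : Fin 3 → ℝ) 1) = 1 := by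
    rw [Real.volume_Icc_pi]; simp
  have hsub : (⋃ π : Fin 6, p1RefCell true π) ⊆ Icc (0 : Fin 3 → ℝ) 1 := by
    intro p hp
    obtain ⟨π, hπ⟩ := mem_iUnion.1 hp
    exact ⟨fun i => (p1RefCell_subset_cube hπ i).1, fun i => (p1RefCell_subset_cube hπ i).2⟩
  have hsup : Icc (0 : Fin 3 → ℝ) 1 ⊆ ⋃ π : Fin 6, p1RefCell true π := by
    intro p hp
    obtain ⟨π, hπ⟩ := exists_p1RefCell true (p := p) fun i => ⟨hp.1 i, hp.2 i⟩
    exact mem_iUnion.2 ⟨π, hπ⟩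
  have hU : volume (⋃ π : Fin 6, p1RefCell true π) = 6 * V := by
    rw [measure_iUnion₀]
    · rw [tsum_fintype]
      simp only [volume_p1RefCell_eq true, ← hV, Finset.sum_const, Finset.card_univ, Fintype.card_fin, nsmul_eq_mul, Nat.cast_ofNat]
    · intro π π' hne
      exact volume_p1RefCell_inter true hne
    · exact fun π => (isClosed_p1RefCell true π).measurableSet.nullMeasurableSet
  have h6 : 6 * V = 1 := le_antisymm (hcube ▸ hU ▸ measure_mono hsub) (hU ▸ hcube ▸ measure_mono hsup)
  calc V = 6⁻¹ * (6 * V) := by rw [← mul_assoc, ENNReal.inv_mul_cancel (by norm_num) (by norm_num), one_mul]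
    _ = 6⁻¹ := by rw [h6, mul_one]

/-! ## The real cells: volume `√3·a²·h/12` -/

/-- Determinant of the slab-affine inverse chart: `det L_k = 2/(√3·a²·h)`. -/
theorem det_p1ChartInvCLM (a h : ℝ) (k : ℤ) :
    LinearMap.det ((p1ChartInvCLM a h k : (Fin 3 → ℝ) →L[ℝ] (Fin 3 → ℝ)) : (Fin 3 → ℝ) →ₗ[ℝ] (Fin 3 → ℝ)) = 2 / (√3 * a ^ 2 * h) := by
  rw [← LinearMap.det_toMatrix', Matrix.det_fin_three]
  simp only [LinearMap.toMatrix'_apply, ContinuousLinearMap.coe_coe, p1ChartInvCLM_apply]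
  simp [p1ChartInvLin]
  ring

/-- A real cell is the preimage of a translated reference piece under the slab-affine inverse chart. -/
theorem p1RealCell_eq_preimage (a h : ℝ) (i : (ℤ × ℤ × ℤ) × Fin 6) :
    p1RealCell a h i = ((p1ChartInvCLM a h i.1.1 : (Fin 3 → ℝ) →L[ℝ] (Fin 3 → ℝ)) : (Fin 3 → ℝ) →ₗ[ℝ] (Fin 3 → ℝ)) ⁻¹'
      ((fun q => (p1ChartInvAff a h i.1.1 0 - p1Vec i.1) + q) ⁻¹' p1RefCell (p1Par i.1) i.2) := by
  rw [p1RealCell_eq]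
  ext y
  simp only [mem_setOf_eq, mem_preimage, p1RefCell, p1FacetFn, ContinuousLinearMap.coe_coe]
  rw [p1ChartInvAff_eq a h i.1.1 y, add_sub_right_comm]
  rfl

/-- **Every real cell (tetrahedron or octahedron-quarter of the hcp honeycomb) has volume `√3·a²·h/12`.** -/
theorem volume_p1RealCell {a h : ℝ} (ha : 0 < a) (hh : 0 < h) (i : (ℤ × ℤ × ℤ) × Fin 6) :
    volume (p1RealCell a h i) = ENNReal.ofReal (√3 * a ^ 2 * h / 12) := by
  have h3 : 0 < √3 := Real.sqrt_pos.2 (by norm_num)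
  have hdet := det_p1ChartInvCLM a h i.1.1
  have hdet0 : LinearMap.det ((p1ChartInvCLM a h i.1.1 : (Fin 3 → ℝ) →L[ℝ] (Fin 3 → ℝ)) : (Fin 3 → ℝ) →ₗ[ℝ] (Fin 3 → ℝ)) ≠ 0 := by
    rw [hdet]; positivity
  rw [p1RealCell_eq_preimage, MeasureTheory.Measure.addHaar_preimage_linearMap volume hdet0, measure_preimage_add, volume_p1RefCell, hdet,
    inv_div, abs_of_pos (by positivity)]
  rw [show (6 : ℝ≥0∞)⁻¹ = ENNReal.ofReal (1 / 6) by rw [one_div, ENNReal.ofReal_inv_of_pos (by norm_num)]; norm_num,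
    ← ENNReal.ofReal_mul (by positivity)]
  congr 1
  ring

/-- The same in real numbers. -/
theorem volume_real_p1RealCell {a h : ℝ} (ha : 0 < a) (hh : 0 < h) (i : (ℤ × ℤ × ℤ) × Fin 6) :
    (volume (p1RealCell a h i)).toReal = √3 * a ^ 2 * h / 12 := by
  rw [volume_p1RealCell ha hh, ENNReal.toReal_ofReal (by positivity)]

/-! ## Weighted cell integrals of gradient functionals -/

/-- **Weighted cell integrals**: `∫_{cell i} w(x)·g(fpGrad v x) dx = g(G_i − A) · ∫_{cell i} w` — e.g. with `w = χ²|x|⁻⁶`, `g = fpRec` this is the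
receipts integral `∫_{cell} χ²·Den(v)` of the far ledger (`fpDen x G = |x|⁻⁶·fpRec G`). -/
theorem setIntegral_p1RealCell_weight_fpGrad {a h : ℝ} (ha : a ≠ 0) (hh : h ≠ 0) (U : ℤ × ℤ × ℤ → (Fin 3 → ℝ)) (b₀ : Fin 3 → ℝ)
    (A : Fin 3 → Fin 3 → ℝ) (i : (ℤ × ℤ × ℤ) × Fin 6) (w : (Fin 3 → ℝ) → ℝ) (g : (Fin 3 → Fin 3 → ℝ) → ℝ) :
    ∫ x in p1RealCell a h i, w x * g (fpGrad (p1Disp a h U b₀ A) x) =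
      g (fun j k => p1CellGrad a h U i j k - A j k) * ∫ x in p1RealCell a h i, w x := by
  rw [setIntegral_congr_ae (isClosed_p1RealCell a h i).measurableSet
      ((fpGrad_p1Disp_ae ha hh U b₀ A i).mono fun x hx hmem => by rw [hx hmem]),
    integral_mul_const, mul_comm]

/-- **The receipts integral of a cell**: `∫_{cell i} χ(x)²·Den(x, ∇v) dx = fpRec(G_i − A) · ∫_{cell i} χ²|x|⁻⁶`. -/
theorem setIntegral_p1RealCell_fpDen {a h : ℝ} (ha : a ≠ 0) (hh : h ≠ 0) (U : ℤ × ℤ × ℤ → (Fin 3 → ℝ)) (b₀ : Fin 3 → ℝ)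
    (A : Fin 3 → Fin 3 → ℝ) (i : (ℤ × ℤ × ℤ) × Fin 6) (χ : (Fin 3 → ℝ) → ℝ) :
    ∫ x in p1RealCell a h i, χ x ^ 2 * fpDen x (fpGrad (p1Disp a h U b₀ A) x) =
      fpRec (fun j k => p1CellGrad a h U i j k - A j k) * ∫ x in p1RealCell a h i, χ x ^ 2 * (fpSq x)⁻¹ ^ 3 := by
  have : ∀ x, χ x ^ 2 * fpDen x (fpGrad (p1Disp a h U b₀ A) x) =
      (χ x ^ 2 * (fpSq x)⁻¹ ^ 3) * fpRec (fpGrad (p1Disp a h U b₀ A) x) := fun x => by rw [fpDen]; ring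
  simp_rw [this]
  exact setIntegral_p1RealCell_weight_fpGrad ha hh U b₀ A i _ fpRec

end Summit.AtomisticToContinuum.Crystallization.Theorems.StrictSplittingRuleBirth
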